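import Literature.MathematicalPhysics.QuantumFieldTheory.Balaban1983to89.B8CubeMemberTorusDomainsL0
import Literature.MathematicalPhysics.QuantumFieldTheory.Balaban1983to89.Node00.CarriersB8CubeDented
import Literature.MathematicalPhysics.QuantumFieldTheory.Balaban1983to89.B8Eq134Admissible

/-!
# `Balaban1983to89.B8CubeMemberTorusDomainsDented` — [Balaban1985Variational] (148)–(150) p. 301 ∕ [Balaban1985RegularSpaces] p. 98–99: THE DENTED CUBE MEMBER
# `(T, t+□₁, …, t+□_{k−1}, t+(□_k ∩ Ω_k))` AS A MEMBER OF THE [B6] §2 TORUS FAMILY WITH `Λ₀` (`B6MultiLevelTorusOperatorL0.TDomains`) — step (d2-a) of the (β) road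

statement-level skeleton of published theorems with citation tags; proofs where landed; nothing here is a claim about the
Yang–Mills mass gap

`[Balaban1985Variational]` ("[15]", CMP **102** (1985) 277–309) (148)–(150) p. 301 («Ω′_j = □_j, j = 0, 1, …, k − 1», the top member of the local sequence cut back to the
part of `□_k` inside `Ω_k`), p. 300 («a cube □ intersecting Ω_j but not Ω_{j+1}»); `[Balaban1985RegularSpaces]` ("B8", CMP **99** (1985) 75–102) p. 98 («for every j the
cube □_j is a sum of the big blocks of the lattice T_{L^{−j}} … a distance between boundaries of these cubes is equal to R₁M₁Lʲη»), (1.3)–(1.4) p. 77 («Ω_j = Bʲ(Ω_j^{(j)}),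
Ω_j is a sum of cubes of a size M₁Lʲη»), (1.131) p. 99; `[Balaban1984PropagatorsII]` ("B6", CMP **96** (1984) 223–250) (2.1)–(2.4) p. 224 («Ω_j^{(j)} is a sum of big
blocks», «(Lʲη)⁻¹dist(Ω_jᶜ, Ω_{j+1}) > RM», «Λ₀ = Ω₁ᶜ»).  PDF held: `paper:balaban1985-cmp102-variational-background` pp. 24–25 (journal pp. 300–301),
`paper:balaban1985-cmp99-regular-spaces-gauge-fixing`.

CITATION HEADER (lean-in-tree rule).  Cell `pub-ymgap` (YM Track A, HUMAN RULING D-0062), DAG node N05 = [B8], seat `pub-ymgap-dag-n05-e` (g31; FAN-OUT §N05 row s3b,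
Proposition-6 lane; piece (d2-a) of the (β) road priced on the bus 2026-08-28 by dag-n05-c I.41357 and this seat I.41343∕I.41847).  WHY THIS FILE.  dag-n05-c's transplant
(`B8Ineq159FlatCubeMemberTransplant.ineq159FlatCubeMemberPrinted_holds`) proves [B8] (1.59) at `U₀ = 1` on the PURE cube member `{□_j}` by reading the member on a
big torus through `B8CubeMemberTorusDomainsL0.cubeTDomainsL0 : B6MultiLevelTorusOperatorL0.TDomains …` and applying lit-balaban's level-0 torus reading
`B8Prop3MultiLevelTorusP26L0.prop3_multiLevelTorus_V1_P26_vector`, which is generic in `D : TDomains …`.  [15] p. 300–301 needs the same estimate for «a cube □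
intersecting Ω_k but not Ω_{k+1}» that may stick out of `Ω_k`: the local sequence `{Ω′_j}` of (148)–(150) is [6]'s tower with its TOP member cut back to `□_k ∩ Ω_k`
(NODE 00's dented datum `Node00.CubeB8D`, its tower `CubeB8D.sq`, p655171).  THIS FILE builds the corresponding `D` — the DENTED member on the torus — so that the chart
twins of dag-n05-c's `B8CubeMemberTorus{Classes,Landau,SizeLines}` and the transplant are token re-keys ((d2-b)∕(d2-c), their lineage), and records the ONE new
geometric premise the dent costs: «`Ω_k` is a union of big `k`-blocks in the chart's frame» ([6] (1.4)₂ at level `k`; [15] p. 300 relies on exactly this to average over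
`□_k ∩ Ω_k`).

WHAT THIS FILE PROVES (kernel-checked; `L = ℓ + 1 ≥ 2`; a dented datum `c : Node00.CubeB8D (d+1) (ℓ+1) K Ω` read at the top truncation `n = c.k`; side conditions as the pure
member: `M_h·L ∣ c.ρ`, `M_h·L ∣ c.M`, `R·(M_h·L) ≤ c.ρ`, `M_h ≥ 2`; host multipliers `P ≥ boxP` componentwise; `t = shift ℓ M_h c.a c.ρ c.k c.k`).
* §1 `levD` — THE DENTED LEVEL FUNCTION: the pure member's `levL0 … c.k` (G1∕T2a) LOWERED TO `c.k − 1` on the dent `t + (□_k ∖ Ω_k)`; `levD_of_dent ∕ levD_of_not_dent ∕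
  levL0_eq_top_of_dent ∕ levD_le ∕ levD_le_levL0`; ★ `le_levD_iff` — `j ≤ levD y ⇔ y − t ∈ c.sq j` for EVERY `1 ≤ j ≤ k` (the dented tower of p655171, uniformly in `j`);
  `levD_pos_iff` (`0 < levD y ⇔ y − t ∈ c.sq 1`: for `k = 1` the dent lies at level `0`).
* §2 ★★ `cubeTDomainsDented … (hΩ) : B6MultiLevelTorusOperatorL0.TDomains d ℓ M_h c.k P R` — THE DENTED MEMBER ON THE TORUS, under the ONE new premise
  `hΩ : ∀ y y′, blk (bigSide ℓ M_h c.k) y′ = blk (bigSide ℓ M_h c.k) y → (y − t ∈ Ω c.k ↔ y′ − t ∈ Ω c.k)` («Ω_k is a sum of cubes of a size M₁Lᵏη» in the chart's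
  frame): (2.1) `bigBlocks` is the pure member's (`B8CubeMemberBoxDomains.mem_cube_iff_of_blk_eq`) for `j < k` and the pure one TOGETHER WITH `hΩ` at `j = k`; (2.2)
  `sepT` is DERIVED from the pure member's `(cubeTDomainsL0 …).sepT` (`levD ≤ levL0` with equality off the dent, and a dent site has `levD = k − 1`, so no pair
  `levD x < j`, `j + 1 ≤ levD x′` is new) — NO condition on `∂Ω_k` inside `□_k`, as print ((150) imposes none); `cubeTDomainsDented_lev` (`rfl`),
  `le_lev_cubeTDomainsDented_iff`, `lev_cubeTDomainsDented_pos_iff`, `cubeTDomainsDented_toDomains_lev`.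
* §3 the premise in `ℤᵈ` letters: `loC_top_eq` (`loC L c.a c.ρ c.k c.k = Lᵏ·(c.a − c.ρ)`, the fine lower corner of `□_k`), `shift_top_eq` (`t = (bigSide)·c.ρ − Lᵏ(c.a − c.ρ)`),
  `blk_add_mul`, ★ `hΩ_of_anchored` — «`Ω c.k` is saturated for the cubes of side `bigSide ℓ M_h c.k` of the grid ANCHORED AT
  `□_k`'s LOWER CORNER `Lᵏ(c.a − c.ρ)`» (`blockMap B (· − Lᵏ(c.a − c.ρ))`-fibres) implies `hΩ` (the translation `t` differs from `−Lᵏ(c.a − c.ρ)` by `B·c.ρ`, a whole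
  number of blocks); `anchored_of_bigCubes14` — [6] (1.4)₂ in NODE 00's standard-grid form `B8Eq134Admissible.BigCubes14 L M₁ Ω` with `M₁ = M_h·L`, together with
  `M₁ ∣ c.a i` and `M₁ ∣ c.ρ` (print p. 98: «□ is a union of cubes of the size R₁M₁Lʲη»), gives the anchored form.
* §4 the identity chart of `B6GlobalChartV1` at the member: `lev_cubeTDomainsDented_toBox`, `le_lev_toBox_iff`.

HONEST SCOPE ∕ NOT CLAIMED.  Geometry and bookkeeping only: the `D` (same host, same `hN` as T2a) at which the level-0 torus reading of (1.59) will be instantiated for the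
dented member; no estimate, no operator identification, no chart twin (those are (d2-b)∕(d2-c)); the dented (1.59)♭ target itself is the sibling definition module
`B8Ineq159FlatDentedCubeMemberPrinted`.  The torus is cubic (inherited from `B6GlobalChartV1`).  Count-neutral; N05 ∕ N07 NOT discharged; one finite `T⁴` programme at
fixed `ε`, Bałaban as printed; nothing continuum ∕ ℝ⁴ ∕ OS ∕ mass-gap ∕ Clay.  No `sorry`, no `instance`, no `notation`; one `def` (`levD`) and one structure-valued `def`
(`cubeTDomainsDented`).  Unit `pub-ymgap-dag-n05-e` (g31), 2026-08-28.

RELATED IN THE TREE, NOT DUPLICATED (`rg` 2026-08-28T19:05Z: `ls Balaban1983to89 | grep -ci 'TorusDomainsDented'` = 0): T2a `B8CubeMemberTorusDomainsL0.cubeTDomainsL0` (the PURE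
member, USED — its `sepT` is re-used, not re-proved), G1 `B8CubeMemberBoxDomainsL0.levL0` (USED), F1 `B8CubeMemberBoxDomains.*` (USED), NODE 00 `Node00.CubeB8D` ∕ `CubeB8D.sq`
(p655171; USED — the dented tower is NOT re-declared), `B8Eq134Admissible.BigCubes14` (USED in §3), `B6MultiLevelTorusOperatorL0.TDomains` (r03; the structure).
-/
noncomputable section

namespace Literature.MathematicalPhysics.QuantumFieldTheory.Balaban1983to89.B8CubeMemberTorusDomainsDented

open B6MultiLevelBoxOperator (N0 bigSide one_le_bigSide)
open B4Reflection242 (boxDom mem_boxDom blk)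
open B4TorusKernel.MultiPeriod (torusSupNorm)
open B8Eq131Cubes (cube cube_anti)
open B8Eq191FlatDirichletDepth (fm loC)
open B8CubeMemberBoxDomains (shift boxP mem_cube_iff_of_blk_eq)
open B8CubeMemberBoxDomainsL0 (levL0 levL0_le le_levL0_iff)
open B8CubeMemberTorusDomainsL0 (cubeTDomainsL0)
open B6GlobalChartV1 (PV toBox)
open B8Eq134Admissible (BigCubes14)
open Node00 (CubeB8D)
open Literature.MathematicalPhysics.QuantumLattice (blockMap)

variable {d : ℕ}

/-! ## §1 The dented level function (truncation `n = k`; level `k − 1` on the dent) -/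

section Lev

variable {ℓ Mh K : ℕ} {Ω : ℕ → Set (Fin (d + 1) → ℤ)}

open Classical in
/-- **THE LEVEL FUNCTION OF THE DENTED MEMBER** `(T, t+□₁, …, t+□_{k−1}, t+(□_k ∩ Ω_k))` at the top truncation: the pure member's `levL0 … k` (deepest `j ≤ k` with
`y − t ∈ □_j`, `0` off `t + □₁`), except on the dent `t + (□_k ∖ Ω_k)`, where the level is `k − 1` — [15] (150): the sites of `□_k` outside `Ω_k` belong to
`Λ′_{k−1}` of the local sequence `{Ω′_j}`. [cite: Balaban1985Variational, (148)–(150) p.301; Balaban1984PropagatorsII, (2.3)–(2.4) p.224] -/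
def levD (Mh : ℕ) (c : CubeB8D (d + 1) (ℓ + 1) K Ω) (y : Fin (d + 1) → ℤ) : ℕ :=
  if y - shift ℓ Mh c.a c.ρ c.k c.k ∈ cube (ℓ + 1) c.a c.M c.ρ c.k c.k ∧ y - shift ℓ Mh c.a c.ρ c.k c.k ∉ Ω c.k then c.k - 1
  else levL0 ℓ Mh c.a c.M c.ρ c.k c.k y

variable (Mh) (c : CubeB8D (d + 1) (ℓ + 1) K Ω)

/-- On the dent `t + (□_k ∖ Ω_k)` the level is `k − 1`. [cite: Balaban1985Variational, (150) p.301] -/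
theorem levD_of_dent {y : Fin (d + 1) → ℤ} (h1 : y - shift ℓ Mh c.a c.ρ c.k c.k ∈ cube (ℓ + 1) c.a c.M c.ρ c.k c.k)
    (h2 : y - shift ℓ Mh c.a c.ρ c.k c.k ∉ Ω c.k) : levD Mh c y = c.k - 1 := by
  classical
  unfold levD; rw [if_pos ⟨h1, h2⟩]

/-- Off the dent the level is the pure member's `levL0 … k`. [cite: Balaban1985Variational, (150) p.301; Balaban1984PropagatorsII, (2.3)–(2.4) p.224] -/
theorem levD_of_not_dent {y : Fin (d + 1) → ℤ}
    (h : ¬ (y - shift ℓ Mh c.a c.ρ c.k c.k ∈ cube (ℓ + 1) c.a c.M c.ρ c.k c.k ∧ y - shift ℓ Mh c.a c.ρ c.k c.k ∉ Ω c.k)) :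
    levD Mh c y = levL0 ℓ Mh c.a c.M c.ρ c.k c.k y := by
  classical
  unfold levD; rw [if_neg h]

/-- A site of `t + □_k` has pure level `k`. [cite: Balaban1984PropagatorsII, (2.3)–(2.4) p.224; Balaban1985RegularSpaces, (1.131) p.99] -/
theorem levL0_eq_top_of_mem {y : Fin (d + 1) → ℤ} (h1 : y - shift ℓ Mh c.a c.ρ c.k c.k ∈ cube (ℓ + 1) c.a c.M c.ρ c.k c.k) :
    levL0 ℓ Mh c.a c.M c.ρ c.k c.k y = c.k := by
  have hle := levL0_le ℓ Mh c.a c.M c.ρ c.k c.one_le_k y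
  have hge := (le_levL0_iff (ℓ := ℓ) (Mh := Mh) c.a c.M c.L_le_ρ le_rfl c.one_le_k le_rfl y).2 h1
  exact le_antisymm hle hge

/-- `levD ≤ k`. [cite: Balaban1984PropagatorsII, (2.3)–(2.4) p.224] -/
theorem levD_le (y : Fin (d + 1) → ℤ) : levD Mh c y ≤ c.k := by
  by_cases h : y - shift ℓ Mh c.a c.ρ c.k c.k ∈ cube (ℓ + 1) c.a c.M c.ρ c.k c.k ∧ y - shift ℓ Mh c.a c.ρ c.k c.k ∉ Ω c.k
  · rw [levD_of_dent Mh c h.1 h.2]; exact Nat.sub_le _ _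
  · rw [levD_of_not_dent Mh c h]; exact levL0_le ℓ Mh c.a c.M c.ρ c.k c.one_le_k y

/-- `levD ≤ levL0 … k`: the dent only LOWERS the pure level (by one, on the dent). [cite: Balaban1985Variational, (150) p.301] -/
theorem levD_le_levL0 (y : Fin (d + 1) → ℤ) : levD Mh c y ≤ levL0 ℓ Mh c.a c.M c.ρ c.k c.k y := by
  by_cases h : y - shift ℓ Mh c.a c.ρ c.k c.k ∈ cube (ℓ + 1) c.a c.M c.ρ c.k c.k ∧ y - shift ℓ Mh c.a c.ρ c.k c.k ∉ Ω c.k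
  · rw [levD_of_dent Mh c h.1 h.2, levL0_eq_top_of_mem Mh c h.1]; exact Nat.sub_le _ _
  · rw [levD_of_not_dent Mh c h]

/-- ★ **`Ω′_j = {j ≤ levD}` IS THE TRANSLATED DENTED TOWER `t + c.sq j`** for every `1 ≤ j ≤ k`: `j ≤ levD y ⇔ y − t ∈ c.sq j` — below the top `c.sq j = □_j`
(`CubeB8D.sq_of_lt`), at the top `c.sq k = □_k ∩ Ω_k` (`CubeB8D.sq_top`). [cite: Balaban1985Variational, (148)–(150) p.301; Balaban1984PropagatorsII, (2.3)–(2.4) p.224; Balaban1985RegularSpaces, (1.131) p.99] -/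
theorem le_levD_iff {j : ℕ} (hj : 1 ≤ j) (hjk : j ≤ c.k) (y : Fin (d + 1) → ℤ) :
    j ≤ levD Mh c y ↔ y - shift ℓ Mh c.a c.ρ c.k c.k ∈ c.sq j := by
  by_cases h : y - shift ℓ Mh c.a c.ρ c.k c.k ∈ cube (ℓ + 1) c.a c.M c.ρ c.k c.k ∧ y - shift ℓ Mh c.a c.ρ c.k c.k ∉ Ω c.k
  · rw [levD_of_dent Mh c h.1 h.2]
    rcases lt_or_eq_of_le hjk with hlt | heq
    · rw [c.sq_of_lt hlt]
      exact ⟨fun _ => cube_anti hlt.le le_rfl h.1, fun _ => by omega⟩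
    · subst heq
      rw [c.sq_top]
      have hk := c.one_le_k
      exact ⟨fun h' => by omega, fun h' => absurd h'.2 h.2⟩
  · rw [levD_of_not_dent Mh c h, le_levL0_iff (ℓ := ℓ) (Mh := Mh) c.a c.M c.L_le_ρ le_rfl hj hjk y]
    rcases lt_or_eq_of_le hjk with hlt | heq
    · rw [c.sq_of_lt hlt]
    · subst heq
      rw [c.sq_top]
      push Not at h
      exact ⟨fun h1 => ⟨h1, h h1⟩, fun h1 => h1.1⟩

/-- **LEVEL `0` OF THE DENTED MEMBER IS `T ∖ (t + Ω′₁)`**: `0 < levD y ⇔ y − t ∈ c.sq 1` (for `k ≥ 2` this is `t + □₁`; for `k = 1` the dent `□₁ ∖ Ω₁` lies at level `0`).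
[cite: Balaban1984PropagatorsII, (2.3)–(2.4) p.224 («Λ₀ = Ω₁ᶜ»); Balaban1985Variational, (150) p.301] -/
theorem levD_pos_iff (y : Fin (d + 1) → ℤ) : 0 < levD Mh c y ↔ y - shift ℓ Mh c.a c.ρ c.k c.k ∈ c.sq 1 :=
  le_levD_iff Mh c le_rfl c.one_le_k y

end Lev

/-! ## §2 The dented member as a level-`0` TORUS family -/

section Member

variable {ℓ Mh K : ℕ} {Ω : ℕ → Set (Fin (d + 1) → ℤ)}

/-- ★★ **THE DENTED CUBE MEMBER `(T, t+□₁, …, t+□_{k−1}, t+(□_k ∩ Ω_k))` IS A MEMBER OF THE [B6] §2 TORUS FAMILY WITH `Λ₀`** (`B6MultiLevelTorusOperatorL0.TDomains d ℓ M_h k P R`):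
levels `0 … k` given by `levD` — `Ω′_j = t + □_j` for `1 ≤ j < k`, `Ω′_k = t + (□_k ∩ Ω_k)`, `Λ₀ = T ∖ (t + Ω′₁)` — with (2.1) «Ω′_j is a sum of big blocks»: for `j < k` the pure
member's law (collar `ρ` and side `M` multiples of `M_hL`, corners aligned by `t`), at `j = k` the same law for `□_k` together with the ONE new premise `hΩ` — «`Ω_k` is a sum
of cubes of a size `M₁Lᵏη`» read in the chart's frame ([6] (1.4)₂; [15] p. 300 uses it to average over `□_k ∩ Ω_k`) — and (2.2) `dist_T(Ω′_jᶜ, Ω′_{j+1}) > R·M_hL^{j+1}` INHERITED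
from the pure member (`B8CubeMemberTorusDomainsL0.cubeTDomainsL0`): the dent only lowers levels from `k` to `k − 1`, so every separated pair of the dented family is a separated
pair of the pure one; NO condition on `∂Ω_k` inside `□_k` ((150) imposes none).  Host: any `P ≥ boxP` componentwise.
[cite: Balaban1985Variational, (148)–(150) p.301, p.300; Balaban1984PropagatorsII, (2.1)–(2.4) p.224, p.229; Balaban1985RegularSpaces, p.98, (1.3)–(1.4) p.77, (1.131) p.99] -/
def cubeTDomainsDented (hℓ : 1 ≤ ℓ) (hMh : 2 ≤ Mh) (c : CubeB8D (d + 1) (ℓ + 1) K Ω) {R : ℕ}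
    (hρ : Mh * (ℓ + 1) ∣ c.ρ) (hM : Mh * (ℓ + 1) ∣ c.M) (hR : R * (Mh * (ℓ + 1)) ≤ c.ρ)
    (P : Fin (d + 1) → ℕ) (hfit : ∀ μ, boxP ℓ c.M c.ρ c.k c.k μ ≤ P μ)
    (hΩ : ∀ y y' : Fin (d + 1) → ℤ, blk (bigSide ℓ Mh c.k) y' = blk (bigSide ℓ Mh c.k) y →
      (y - shift ℓ Mh c.a c.ρ c.k c.k ∈ Ω c.k ↔ y' - shift ℓ Mh c.a c.ρ c.k c.k ∈ Ω c.k)) :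
    B6MultiLevelTorusOperatorL0.TDomains d ℓ Mh c.k P R where
  lev := levD Mh c
  lev_le := levD_le Mh c
  bigBlocks := by
    have hMh1 : 1 ≤ Mh := le_trans (by norm_num) hMh
    intro j hj y _ y' _ hyy
    by_cases hjk : j ≤ c.k
    · rw [le_levD_iff Mh c hj hjk y, le_levD_iff Mh c hj hjk y']
      rcases lt_or_eq_of_le hjk with hlt | heq
      · rw [c.sq_of_lt hlt]
        exact mem_cube_iff_of_blk_eq hMh1 c.a hρ hM hjk le_rfl hyy
      · subst heq
        rw [c.sq_top, Set.mem_inter_iff, Set.mem_inter_iff]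
        exact and_congr (mem_cube_iff_of_blk_eq hMh1 c.a hρ hM le_rfl le_rfl hyy) (hΩ y y' hyy)
    · have h1 := levD_le Mh c y
      have h2 := levD_le Mh c y'
      constructor <;> intro h <;> omega
  sepT := by
    have hρ0 : 0 < c.ρ := lt_of_lt_of_le (Nat.succ_pos ℓ) c.L_le_ρ
    intro j y hy y' hy' hlt hle
    have hD := (cubeTDomainsL0 (d := d) hℓ hMh c.a c.one_le_k le_rfl hρ hM hρ0 hR P hfit).sepT j y hy y' hy'
    refine hD ?_ (hle.trans (levD_le_levL0 Mh c y'))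
    show levL0 ℓ Mh c.a c.M c.ρ c.k c.k y < j
    by_cases h : y - shift ℓ Mh c.a c.ρ c.k c.k ∈ cube (ℓ + 1) c.a c.M c.ρ c.k c.k ∧ y - shift ℓ Mh c.a c.ρ c.k c.k ∉ Ω c.k
    · exfalso
      rw [levD_of_dent Mh c h.1 h.2] at hlt
      have h2 := levD_le Mh c y'
      omega
    · rw [← levD_of_not_dent Mh c h]; exact hlt

/-- The level function of the dented torus member is `levD`. [cite: Balaban1984PropagatorsII, (2.3)–(2.4) p.224; Balaban1985Variational, (150) p.301] -/
theorem cubeTDomainsDented_lev (hℓ : 1 ≤ ℓ) (hMh : 2 ≤ Mh) (c : CubeB8D (d + 1) (ℓ + 1) K Ω) {R : ℕ}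
    (hρ : Mh * (ℓ + 1) ∣ c.ρ) (hM : Mh * (ℓ + 1) ∣ c.M) (hR : R * (Mh * (ℓ + 1)) ≤ c.ρ)
    (P : Fin (d + 1) → ℕ) (hfit : ∀ μ, boxP ℓ c.M c.ρ c.k c.k μ ≤ P μ)
    (hΩ : ∀ y y' : Fin (d + 1) → ℤ, blk (bigSide ℓ Mh c.k) y' = blk (bigSide ℓ Mh c.k) y →
      (y - shift ℓ Mh c.a c.ρ c.k c.k ∈ Ω c.k ↔ y' - shift ℓ Mh c.a c.ρ c.k c.k ∈ Ω c.k)) :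
    (cubeTDomainsDented hℓ hMh c hρ hM hR P hfit hΩ).lev = levD Mh c := rfl

/-- The box family of the dented torus member has the same level function (`TDomains.toDomains`). [cite: Balaban1984PropagatorsII, (2.1)–(2.4) p.224, dictionary] -/
theorem cubeTDomainsDented_toDomains_lev (hℓ : 1 ≤ ℓ) (hMh : 2 ≤ Mh) (c : CubeB8D (d + 1) (ℓ + 1) K Ω) {R : ℕ}
    (hρ : Mh * (ℓ + 1) ∣ c.ρ) (hM : Mh * (ℓ + 1) ∣ c.M) (hR : R * (Mh * (ℓ + 1)) ≤ c.ρ)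
    (P : Fin (d + 1) → ℕ) (hfit : ∀ μ, boxP ℓ c.M c.ρ c.k c.k μ ≤ P μ)
    (hΩ : ∀ y y' : Fin (d + 1) → ℤ, blk (bigSide ℓ Mh c.k) y' = blk (bigSide ℓ Mh c.k) y →
      (y - shift ℓ Mh c.a c.ρ c.k c.k ∈ Ω c.k ↔ y' - shift ℓ Mh c.a c.ρ c.k c.k ∈ Ω c.k)) :
    (B6MultiLevelTorusOperatorL0.TDomains.toDomains (cubeTDomainsDented hℓ hMh c hρ hM hR P hfit hΩ)).lev = levD Mh c := rfl

/-- ★ **`Ω′_j = {j ≤ lev}` OF THE DENTED TORUS MEMBER IS THE TRANSLATED `c.sq j`** (`1 ≤ j ≤ k`). [cite: Balaban1985Variational, (148)–(150) p.301; Balaban1984PropagatorsII, (2.3)–(2.4) p.224] -/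
theorem le_lev_cubeTDomainsDented_iff (hℓ : 1 ≤ ℓ) (hMh : 2 ≤ Mh) (c : CubeB8D (d + 1) (ℓ + 1) K Ω) {R : ℕ}
    (hρ : Mh * (ℓ + 1) ∣ c.ρ) (hM : Mh * (ℓ + 1) ∣ c.M) (hR : R * (Mh * (ℓ + 1)) ≤ c.ρ)
    (P : Fin (d + 1) → ℕ) (hfit : ∀ μ, boxP ℓ c.M c.ρ c.k c.k μ ≤ P μ)
    (hΩ : ∀ y y' : Fin (d + 1) → ℤ, blk (bigSide ℓ Mh c.k) y' = blk (bigSide ℓ Mh c.k) y →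
      (y - shift ℓ Mh c.a c.ρ c.k c.k ∈ Ω c.k ↔ y' - shift ℓ Mh c.a c.ρ c.k c.k ∈ Ω c.k))
    {j : ℕ} (hj : 1 ≤ j) (hjk : j ≤ c.k) (y : Fin (d + 1) → ℤ) :
    j ≤ (cubeTDomainsDented hℓ hMh c hρ hM hR P hfit hΩ).lev y ↔ y - shift ℓ Mh c.a c.ρ c.k c.k ∈ c.sq j :=
  le_levD_iff Mh c hj hjk y

/-- **LEVEL `0` OF THE DENTED TORUS MEMBER IS `T ∖ (t + Ω′₁)`**. [cite: Balaban1984PropagatorsII, (2.3)–(2.4) p.224 («Λ₀ = Ω₁ᶜ»); Balaban1985Variational, (150) p.301] -/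
theorem lev_cubeTDomainsDented_pos_iff (hℓ : 1 ≤ ℓ) (hMh : 2 ≤ Mh) (c : CubeB8D (d + 1) (ℓ + 1) K Ω) {R : ℕ}
    (hρ : Mh * (ℓ + 1) ∣ c.ρ) (hM : Mh * (ℓ + 1) ∣ c.M) (hR : R * (Mh * (ℓ + 1)) ≤ c.ρ)
    (P : Fin (d + 1) → ℕ) (hfit : ∀ μ, boxP ℓ c.M c.ρ c.k c.k μ ≤ P μ)
    (hΩ : ∀ y y' : Fin (d + 1) → ℤ, blk (bigSide ℓ Mh c.k) y' = blk (bigSide ℓ Mh c.k) y →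
      (y - shift ℓ Mh c.a c.ρ c.k c.k ∈ Ω c.k ↔ y' - shift ℓ Mh c.a c.ρ c.k c.k ∈ Ω c.k)) (y : Fin (d + 1) → ℤ) :
    0 < (cubeTDomainsDented hℓ hMh c hρ hM hR P hfit hΩ).lev y ↔ y - shift ℓ Mh c.a c.ρ c.k c.k ∈ c.sq 1 :=
  levD_pos_iff Mh c y

end Member

/-! ## §3 The one new premise in `ℤᵈ` letters: `Ω_k` a union of big `k`-blocks of the grid anchored at `□_k`'s lower corner -/

section Anchored

variable {ℓ Mh K : ℕ} {Ω : ℕ → Set (Fin (d + 1) → ℤ)}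

/-- The fine lower corner of `□_k` is `Lᵏ·(a − ρ)` (`m_k = ρLᵏ`: `□_k^{(k)} = [a − ρ, a + M + ρ)ᵈ`). [cite: Balaban1985RegularSpaces, p.98 («dist … equal to R₁M₁Lʲη»), (1.131) p.99] -/
theorem loC_top_eq (L : ℕ) (a : Fin (d + 1) → ℤ) (ρ k : ℕ) : loC L a ρ k k = fun i => (L : ℤ) ^ k * (a i - ρ) := by
  funext i
  simp only [loC, B8Eq131Cubes.bLo, fm, Nat.sub_self, B8Eq131Cubes.gs_zero, mul_one]
  push_cast
  ring

/-- The aligning translation at the top truncation: `t = (M_hL^{k+1})·ρ − Lᵏ(a − ρ)` — `□_k`'s corner goes to `ρ` big `k`-blocks from the origin. [cite: Balaban1985RegularSpaces, p.98; Balaban1984PropagatorsII, (2.1) p.224] -/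
theorem shift_top_eq (ℓ Mh : ℕ) (a : Fin (d + 1) → ℤ) (ρ k : ℕ) :
    shift ℓ Mh a ρ k k = fun i => (bigSide ℓ Mh k : ℤ) * ρ - (((ℓ + 1 : ℕ) : ℤ)) ^ k * (a i - ρ) := by
  funext i
  simp only [shift, bigSide, loC_top_eq]
  push_cast
  ring

/-- Translating by a whole number `q` of blocks shifts the block label by `q`: `blk b (x + b·q) = blk b x + q` (`b ≥ 1`). [folklore] [cite: Balaban1984PropagatorsII, (2.1) p.224, dictionary] -/
theorem blk_add_mul (b : ℕ) (hb : 1 ≤ b) (x : Fin (d + 1) → ℤ) (q : ℤ) :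
    blk b (fun i => x i + (b : ℤ) * q) = fun i => blk b x i + q := by
  funext i
  have hb0 : (b : ℤ) ≠ 0 := by exact_mod_cast (by omega : b ≠ 0)
  simp only [blk]
  rw [mul_comm, Int.add_mul_ediv_right _ _ hb0]

/-- ★ **THE ANCHORED `ℤᵈ` FORM OF THE PREMISE IMPLIES THE CHART FORM**: if `Ω_k` is saturated for the cubes of side `B = bigSide ℓ M_h k = M_hL^{k+1}` of the grid
anchored at `□_k`'s fine lower corner `Lᵏ(c.a − c.ρ)` («Ω_k is a sum of cubes of a size M₁Lᵏη», M₁ = M_hL, on the grid carrying `□_k` — p. 98 «□_j is a sum of the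
big blocks»), then membership of `y − t` in `Ω_k` depends only on the big `k`-block of `y` (the premise `hΩ` of `cubeTDomainsDented`): `t + Lᵏ(c.a − c.ρ) = B·c.ρ` is a
whole number of blocks. [cite: Balaban1985RegularSpaces, (1.4) p.77, p.98; Balaban1984PropagatorsII, (2.1) p.224; Balaban1985Variational, p.300] -/
theorem hΩ_of_anchored (hMh : 1 ≤ Mh) (c : CubeB8D (d + 1) (ℓ + 1) K Ω)
    (h : ∀ x x' : Fin (d + 1) → ℤ,
      blockMap (bigSide ℓ Mh c.k) (x - fun i => (((ℓ + 1 : ℕ) : ℤ)) ^ c.k * (c.a i - c.ρ)) =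
        blockMap (bigSide ℓ Mh c.k) (x' - fun i => (((ℓ + 1 : ℕ) : ℤ)) ^ c.k * (c.a i - c.ρ)) → x ∈ Ω c.k → x' ∈ Ω c.k) :
    ∀ y y' : Fin (d + 1) → ℤ, blk (bigSide ℓ Mh c.k) y' = blk (bigSide ℓ Mh c.k) y →
      (y - shift ℓ Mh c.a c.ρ c.k c.k ∈ Ω c.k ↔ y' - shift ℓ Mh c.a c.ρ c.k c.k ∈ Ω c.k) := by
  have hB : 1 ≤ bigSide ℓ Mh c.k := one_le_bigSide hMh c.k
  -- `(y − t) − Lᵏ(a − ρ) = y + B·(−ρ)`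
  have key : ∀ y : Fin (d + 1) → ℤ,
      (y - shift ℓ Mh c.a c.ρ c.k c.k) - (fun i => (((ℓ + 1 : ℕ) : ℤ)) ^ c.k * (c.a i - c.ρ)) =
        fun i => y i + (bigSide ℓ Mh c.k : ℤ) * (-(c.ρ : ℤ)) := by
    intro y
    funext i
    rw [shift_top_eq]
    simp only [Pi.sub_apply]
    ring
  have hlab : ∀ y : Fin (d + 1) → ℤ,
      blockMap (bigSide ℓ Mh c.k) ((y - shift ℓ Mh c.a c.ρ c.k c.k) - fun i => (((ℓ + 1 : ℕ) : ℤ)) ^ c.k * (c.a i - c.ρ)) =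
        fun i => blk (bigSide ℓ Mh c.k) y i + (-(c.ρ : ℤ)) := by
    intro y
    rw [key y]
    -- `blockMap b = blk b` on `ℤ^{d+1}` definitionally (`B9B8AveragingJunction.blk_eq_blockMap`)
    exact blk_add_mul _ hB y (-(c.ρ : ℤ))
  intro y y' hyy
  have heq : blockMap (bigSide ℓ Mh c.k) ((y - shift ℓ Mh c.a c.ρ c.k c.k) - fun i => (((ℓ + 1 : ℕ) : ℤ)) ^ c.k * (c.a i - c.ρ)) =
      blockMap (bigSide ℓ Mh c.k) ((y' - shift ℓ Mh c.a c.ρ c.k c.k) - fun i => (((ℓ + 1 : ℕ) : ℤ)) ^ c.k * (c.a i - c.ρ)) := by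
    rw [hlab y, hlab y', hyy]
  exact ⟨fun hy => h _ _ heq hy, fun hy' => h _ _ heq.symm hy'⟩

/-- **[6] (1.4)₂ ON THE STANDARD GRID, WITH `□_k` ON THAT GRID, GIVES THE ANCHORED FORM**: if every `Ω_j` is a union of `M₁Lʲ`-cubes of the standard partition
(`B8Eq134Admissible.BigCubes14 L M₁ Ω`, NODE 00's letters) and `□_k`'s corner data are multiples of `M₁` (`M₁ ∣ c.a i`, `M₁ ∣ c.ρ` — print p. 98 «□ is a union of cubes
of the size R₁M₁Lʲη», «M a multiple of R₁M₁»), then `Ω_k` is saturated for the `M₁Lᵏ`-cubes anchored at `Lᵏ(c.a − c.ρ)` (the anchor is itself a grid point).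
[cite: Balaban1985RegularSpaces, (1.4) p.77, p.98; Balaban1985Variational, p.300] -/
theorem anchored_of_bigCubes14 {L M₁ : ℕ} {K' : ℕ} {Ω' : ℕ → Set (Fin (d + 1) → ℤ)} (c : CubeB8D (d + 1) L K' Ω')
    (hbig : BigCubes14 L M₁ Ω') (ha : ∀ i, (M₁ : ℤ) ∣ c.a i) (hρ : (M₁ : ℤ) ∣ (c.ρ : ℤ)) :
    ∀ x x' : Fin (d + 1) → ℤ,
      blockMap (M₁ * L ^ c.k) (x - fun i => (L : ℤ) ^ c.k * (c.a i - c.ρ)) =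
        blockMap (M₁ * L ^ c.k) (x' - fun i => (L : ℤ) ^ c.k * (c.a i - c.ρ)) → x ∈ Ω' c.k → x' ∈ Ω' c.k := by
  intro x x' hxx hx
  -- the anchor is `(M₁Lᵏ)·q` for an integer vector `q`
  have hq : ∀ i, ∃ q : ℤ, (L : ℤ) ^ c.k * (c.a i - c.ρ) = ((M₁ * L ^ c.k : ℕ) : ℤ) * q := by
    intro i
    obtain ⟨u, hu⟩ := ha i
    obtain ⟨v, hv⟩ := hρ
    refine ⟨u - v, ?_⟩
    rw [hu, hv]; push_cast; ring
  choose q hq using hq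
  rcases Nat.eq_zero_or_pos (M₁ * L ^ c.k) with h0 | hpos
  · -- degenerate block size `0`: `blockMap 0` is constant, and `BigCubes14` then makes `Ω_k` all or nothing
    refine hbig c.k x x' ?_ hx
    funext i
    simp [blockMap, h0]
  · refine hbig c.k x x' ?_ hx
    have hb0 : ((M₁ * L ^ c.k : ℕ) : ℤ) ≠ 0 := by exact_mod_cast (Nat.pos_iff_ne_zero.mp hpos)
    have hshift : ∀ z : Fin (d + 1) → ℤ,
        blockMap (M₁ * L ^ c.k) (z - fun i => (L : ℤ) ^ c.k * (c.a i - c.ρ)) = fun i => blockMap (M₁ * L ^ c.k) z i + (-q i) := by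
      intro z; funext i
      simp only [blockMap, Pi.sub_apply]
      rw [hq i, show z i - ((M₁ * L ^ c.k : ℕ) : ℤ) * q i = z i + (-q i) * ((M₁ * L ^ c.k : ℕ) : ℤ) by ring,
        Int.add_mul_ediv_right _ _ hb0]
    have h1 := hxx
    rw [hshift x, hshift x'] at h1
    funext i
    have := congrFun h1 i
    linarith

end Anchored

/-! ## §4 The identity chart of the V1 torus at the dented member -/

section Chart

variable {ℓ Mh K : ℕ} {Ω : ℕ → Set (Fin (d + 1) → ℤ)} {mV KV : ℕ} {hd : 1 ≤ d + 1} {hL : Odd (ℓ + 1) ∧ 1 < ℓ + 1}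

/-- **THE TORUS LEVEL OF A V1 SITE IS `levD` OF ITS LABEL VECTOR** (identity chart `B6GlobalChartV1.toBox`; definitional, recorded for the consumers of `blkV1`∕`domT`).
[cite: Balaban1984PropagatorsII, (2.1)–(2.4) p.224, dictionary; Balaban1985Variational, (150) p.301] -/
theorem lev_cubeTDomainsDented_toBox (hℓ : 1 ≤ ℓ) (hMh : 2 ≤ Mh) (c : CubeB8D (d + 1) (ℓ + 1) K Ω) {R : ℕ}
    (hρ : Mh * (ℓ + 1) ∣ c.ρ) (hM : Mh * (ℓ + 1) ∣ c.M) (hR : R * (Mh * (ℓ + 1)) ≤ c.ρ)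
    {P : Fin (d + 1) → ℕ} (hfit : ∀ μ, boxP ℓ c.M c.ρ c.k c.k μ ≤ P μ)
    (hΩ : ∀ y y' : Fin (d + 1) → ℤ, blk (bigSide ℓ Mh c.k) y' = blk (bigSide ℓ Mh c.k) y →
      (y - shift ℓ Mh c.a c.ρ c.k c.k ∈ Ω c.k ↔ y' - shift ℓ Mh c.a c.ρ c.k c.k ∈ Ω c.k))
    (hN : ∀ μ, N0 ℓ Mh c.k P μ = (PV d ℓ mV KV hd hL).sitesPerDir 0) (x : Site (PV d ℓ mV KV hd hL) 0) :
    (cubeTDomainsDented hℓ hMh c hρ hM hR P hfit hΩ).lev (toBox hN x : Fin (d + 1) → ℤ) = levD Mh c (fun μ => ((x μ).val : ℤ)) := rfl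

/-- **A V1 SITE LIES IN THE TRANSLATED `Ω′_j` IFF ITS LABEL VECTOR DOES** (`1 ≤ j ≤ k`), read through the dented member's level function
(face name parallel to `B8CubeMemberTorusDomainsL0.le_lev_toBox_iff`, dag-n05-c's ask I.42243). [cite: Balaban1984PropagatorsII, (2.1)–(2.4) p.224; Balaban1985Variational, (148)–(150) p.301] -/
theorem le_lev_toBox_iff (hℓ : 1 ≤ ℓ) (hMh : 2 ≤ Mh) (c : CubeB8D (d + 1) (ℓ + 1) K Ω) {R : ℕ}
    (hρ : Mh * (ℓ + 1) ∣ c.ρ) (hM : Mh * (ℓ + 1) ∣ c.M) (hR : R * (Mh * (ℓ + 1)) ≤ c.ρ)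
    {P : Fin (d + 1) → ℕ} (hfit : ∀ μ, boxP ℓ c.M c.ρ c.k c.k μ ≤ P μ)
    (hΩ : ∀ y y' : Fin (d + 1) → ℤ, blk (bigSide ℓ Mh c.k) y' = blk (bigSide ℓ Mh c.k) y →
      (y - shift ℓ Mh c.a c.ρ c.k c.k ∈ Ω c.k ↔ y' - shift ℓ Mh c.a c.ρ c.k c.k ∈ Ω c.k))
    (hN : ∀ μ, N0 ℓ Mh c.k P μ = (PV d ℓ mV KV hd hL).sitesPerDir 0)
    {j : ℕ} (hj : 1 ≤ j) (hjk : j ≤ c.k) (x : Site (PV d ℓ mV KV hd hL) 0) :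
    j ≤ (cubeTDomainsDented hℓ hMh c hρ hM hR P hfit hΩ).lev (toBox hN x : Fin (d + 1) → ℤ) ↔
      (fun μ => ((x μ).val : ℤ)) - shift ℓ Mh c.a c.ρ c.k c.k ∈ c.sq j :=
  le_levD_iff Mh c hj hjk _

end Chart

end Literature.MathematicalPhysics.QuantumFieldTheory.Balaban1983to89.B8CubeMemberTorusDomainsDented
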